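import Summits.Parity.GeneralizedHardyLittlewood.Theses.ChenParityOracleBLAP
import Summits.Parity.GeneralizedHardyLittlewood.Theorems.ChenParityOracleBLAPHostParityFromBrickPrimeHost
import Summits.Parity.GeneralizedHardyLittlewood.Theorems.ChenParityOracleBLAPHostParityFromBrickSwitchedHost
import HarnessLib

/-!
# Route `ChenParityOracleBLAP` — crux S1 = `HostParityFromBrick` (stmt-Parity-20045), closed

S1 of the route: the bilinear-Liouville brick — K1 = `BilinearLiouvilleMean` (Type-II mean bound
for `λ(mn ± 2)`) and K2 = `BilinearLiouvilleAP` (its progression version at level `x^{1/2−ε}`),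
both OPEN — implies BOTH host-parity level statements: HP1 for the prime host
(`hostParity_prime`, file `…PrimeHost`) and HP2 for Chen's switched host (`hostParity_switched`,
file `…SwitchedHost`).  `hostParityFromBrick_proof` is literally the route declaration
`HostParityFromBrick = (K1 → K2 → HP1 ∧ HP2)`.  Honesty: a CONDITIONAL reduction (bookkeeping of
Vaughan/Type-I/Type-II dispatch into the K-window); K1 and K2 remain open and are where the parity
barrier sits.

References: E. Bombieri, J. Friedlander, H. Iwaniec, Acta Math. 156 (1986) [BFI1986];
R. C. Vaughan, Acta Arith. 37 (1980) [Vaughan1980]; Chen Jing-run, Sci. Sinica 16 (1973)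
[ChenSciSinica1973].
-/

namespace Summit.Parity.GeneralizedHardyLittlewood.Theorems

open Summit.Parity.GeneralizedHardyLittlewood.Theses.ChenParityOracleBLAP

/-- **S1 (`HostParityFromBrick`) holds**: `K1 → K2 → (HP1 ∧ HP2)`. -/
theorem hostParityFromBrick_proof :
    Summit.Parity.GeneralizedHardyLittlewood.Theses.ChenParityOracleBLAP.HostParityFromBrick :=
  fun k₁ k₂ => ⟨hostParity_prime k₁ k₂, hostParity_switched k₁ k₂⟩

end Summit.Parity.GeneralizedHardyLittlewood.Theorems
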